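import Mathlib
import Literature.NumberTheory.Automorphic.HilbertModularFormQExpansion
import Literature.NumberTheory.Automorphic.CongruenceSubgroupPropertySL2Holds

/-!
# Vaserstein generation of `Γ₁((q))` (stub stub_gamma1_le_closure of line Sketch-ideate-r1-k1)

For a totally real number field `F` of degree `≥ 2` and `q ∈ 𝓞 F`, `q ≠ 0`, the congruence
subgroup `Γ₁((q)) = {γ ∈ SL₂(𝓞 F) : γ₁₀ ∈ (q), γ₁₁ ≡ 1 (mod q)}` (`Bianchi.Gamma1`) is contained
in the subgroup generated by the translations `E₁₂(b)`, `b ∈ 𝓞 F`, and the lower unipotents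
`E₂₁(c)`, `c ∈ (q)`.

Proof: conjugate the tree's Vaserstein theorem `SL2Rel.relG_le_relE_span_singleton`
(`G((q), 𝓞 F) ≤ E((q), 𝓞 F) = ⟨E₁₂((q)), E₂₁(𝓞 F)⟩`, hypotheses: a real place and a unit of
infinite order, `exists_isReal_of_isTotallyReal`, `exists_unit_pow_ne_one`) by the Weyl element
`w = (0 -1; 1 0)` (`SL2Rel.weylElt`): for `γ ∈ Γ₁((q))` the conjugate `w⁻¹ γ w = (d, -c; -b, a)`
lies in `G((q), 𝓞 F)` (as `a - 1 ∈ (q)` follows from `ad - bc = 1`), hence in `E((q), 𝓞 F)`, and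
`w E₁₂(x) w⁻¹ = E₂₁(-x)`, `w E₂₁(y) w⁻¹ = E₁₂(-y)` carry the generators of `E((q), 𝓞 F)` into the
target generating set.
-/

set_option linter.dupNamespace false

noncomputable section

namespace Summit.Langlands.Langlands.Theorems.HilbertIntegralOverconvergentIsCongruence

open MeasureTheory Complex NumberField
open Literature.NumberTheory.Automorphic Literature.NumberTheory.Automorphic.HilbertModular
open scoped MatrixGroups

/-- For `γ ∈ Γ₁(𝔫)` also `γ₀₀ - 1 ∈ 𝔫` (from `det γ = 1`). [folklore] -/
theorem glc_apply_00_sub_one_mem {R : Type*} [CommRing R] {𝔫 : Ideal R} {γ : SL(2, R)}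
    (hγ : γ ∈ Bianchi.Gamma1 𝔫) : γ 0 0 - 1 ∈ 𝔫 := by
  obtain ⟨hc, hd⟩ := hγ
  have hdet : γ 0 0 * γ 1 1 - γ 0 1 * γ 1 0 = 1 := by
    have h := γ.det_coe
    rw [Matrix.det_fin_two] at h
    exact h
  have e : γ 0 0 - 1 = -(γ 0 0 * (γ 1 1 - 1)) + γ 0 1 * γ 1 0 := by linear_combination hdet
  rw [e]
  exact 𝔫.add_mem (𝔫.neg_mem (𝔫.mul_mem_left _ hd)) (𝔫.mul_mem_left _ hc)

/-- `w⁻¹ γ w ∈ G(𝔫, R)` for `γ ∈ Γ₁(𝔫)` and the Weyl element `w = (0 -1; 1 0)`: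
`w⁻¹ γ w = (d, -c; -b, a)`. [folklore] -/
theorem glc_weylElt_inv_conj_mem_relG {R : Type*} [CommRing R] {𝔫 : Ideal R} {γ : SL(2, R)}
    (hγ : γ ∈ Bianchi.Gamma1 𝔫) :
    (SL2Rel.weylElt : SL(2, R))⁻¹ * γ * SL2Rel.weylElt ∈ SL2Rel.relG 𝔫 ⊤ := by
  obtain ⟨h00, h01, h10, h11⟩ := SL2Rel.weylElt_inv_mul_mul_apply γ
  rw [SL2Rel.mem_relG, Ideal.mul_top, h00, h01, h10, h11]
  exact ⟨𝔫.neg_mem hγ.1, Submodule.mem_top, hγ.2, glc_apply_00_sub_one_mem hγ⟩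

/-- Conjugation by the Weyl element `w` carries `E(𝔫, R) = ⟨E₁₂(𝔫), E₂₁(R)⟩` into the subgroup
generated by all the `E₁₂(b)`, `b ∈ R`, and the `E₂₁(c)`, `c ∈ 𝔫` (as `w E₁₂(x) w⁻¹ = E₂₁(-x)` and
`w E₂₁(y) w⁻¹ = E₁₂(-y)`). [folklore] -/
theorem glc_map_conj_weylElt_relE_le {R : Type*} [CommRing R] (𝔫 : Ideal R) :
    (SL2Rel.relE 𝔫 ⊤).map (MulAut.conj (SL2Rel.weylElt : SL(2, R))).toMonoidHom ≤
      Subgroup.closure ((Set.range fun b : R ↦ SL2Rel.e12 b) ∪ (SL2Rel.e21 '' (𝔫 : Set R))) := by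
  rw [SL2Rel.relE, MonoidHom.map_closure, Subgroup.closure_le]
  rintro _ ⟨M, hM | hM, rfl⟩
  · obtain ⟨x, hx, rfl⟩ := hM
    rw [MulEquiv.coe_toMonoidHom, MulAut.conj_apply, SL2Rel.weylElt_mul_e12_mul_inv]
    exact Subgroup.subset_closure (Or.inr ⟨-x, 𝔫.neg_mem hx, rfl⟩)
  · obtain ⟨y, -, rfl⟩ := hM
    rw [MulEquiv.coe_toMonoidHom, MulAut.conj_apply, SL2Rel.weylElt_mul_e21_mul_inv]
    exact Subgroup.subset_closure (Or.inl ⟨-y, rfl⟩)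

/-- **stub V6 — `stub_gamma1_le_closure` (M; Vaserstein generation of `Γ₁((q))`).** Over a totally real `F` of degree `≥ 2` and
`q ≠ 0`: `Γ₁((q))` is contained in the subgroup of `SL₂(𝓞F)` generated by the translations `(1 b; 0 1)`, `b ∈ 𝓞F`, and the lower
unipotents `(1 0; c 1)`, `c ∈ (q)` — conjugate the tree's `SL2Rel.relG_le_relE_span_singleton` (`G((q), 𝓞) ≤ E((q), 𝓞)`, Vaserstein's theorem,
hypotheses `exists_isReal_of_isTotallyReal`, `exists_unit_pow_ne_one F hd`) by the Weyl element `(0 -1; 1 0)`, which swaps `e12 ↔ e21` (up to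
sign) and carries `G((q), 𝓞)` onto `Γ₁((q))`. [cite: Vaserstein1972SL2, Theorem] -/
theorem stub_gamma1_le_closure (F : Type) [Field F] [NumberField F] [NumberField.IsTotallyReal F]
    (hd : 1 < Module.finrank ℚ F) (q : 𝓞 F) (hq : q ≠ 0) :
    Bianchi.Gamma1 (Ideal.span {q}) ≤
      Subgroup.closure ((Set.range fun b : 𝓞 F ↦ SL2Rel.e12 b) ∪
        (SL2Rel.e21 '' (Ideal.span {q} : Set (𝓞 F)))) := by
  intro γ hγ
  have hγ' : (SL2Rel.weylElt : SL(2, 𝓞 F))⁻¹ * γ * SL2Rel.weylElt ∈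
      SL2Rel.relE (Ideal.span {q}) (⊤ : Ideal (𝓞 F)) :=
    SL2Rel.relG_le_relE_span_singleton (exists_isReal_of_isTotallyReal F)
      (exists_unit_pow_ne_one F hd) hq (glc_weylElt_inv_conj_mem_relG hγ)
  have hmem := glc_map_conj_weylElt_relE_le (Ideal.span {q})
    (Subgroup.mem_map_of_mem (MulAut.conj (SL2Rel.weylElt : SL(2, 𝓞 F))).toMonoidHom hγ')
  rwa [MulEquiv.coe_toMonoidHom, MulAut.conj_apply,
    show (SL2Rel.weylElt : SL(2, 𝓞 F)) * ((SL2Rel.weylElt)⁻¹ * γ * SL2Rel.weylElt) *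
      (SL2Rel.weylElt)⁻¹ = γ by group] at hmem

end Summit.Langlands.Langlands.Theorems.HilbertIntegralOverconvergentIsCongruence
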